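import Literature.AlgebraicGeometry.Frobenioids.PadicKummerLocalFieldIso
import HarnessLib

/-!
# Frobenioids II, Theorem 2.4 (i) / Definition 2.2 (iii): a valuative field isomorphism carries
# `O^⊳_{L₁}`, `O^×_{L₁}` onto `O^⊳_{L₂}`, `O^×_{L₂}`

Mochizuki, *The geometry of Frobenioids II*, Kyushu J. Math. **62** (2008) 401–460, §2, Definition 2.2
(iii) p. 18 (`O^□ := O^⊳` or `O^×`) and Theorem 2.4 (i) p. 20 ("`Ψ` preserves `O^⊳(−)`")
[cite: MochizukiFrdII2008, Thm 2.4 (i) p.20].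

PROOF-SIDE companion (seat abc-iut-L1-d4, gen 2) to `PadicKummerLocalFieldIso.lean`: the hypothesis
`hS` of `Def22Context.Iso.ofLocalField` ("`φ` carries the stable submonoid `S₁` onto `S₂`") is
DISCHARGED for abc-iut-L1-t7's canonical choices `triSubmonoid` (`O^⊳_L`, the nonzero
`𝒪_K`-integral elements — abc-iut-L4-t2's `nonzeroIntegers`), `unitsStableSubmonoid` (`O^×_L`) and
`boxStableSubmonoid` (Def. 2.2 (iii)), whenever the base isomorphism `φ₀ : K₁ ⥲ K₂` identifies the
valuation rings (`hφ₀ : x ∈ 𝒪_{K₁} ↔ φ₀ x ∈ 𝒪_{K₂}`, automatic for an isomorphism of valued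
fields): integrality transports along the `φ₀`-semilinear `φ|_{L₁}` (`IsIntegral.map_of_comp_eq`).
Consequently the context isomorphisms `Iso.ofLocalFieldTri` / `…Units` / `…Box` between the
arithmetic contexts with `O^□ = O^⊳`, `O^×`, `O^□` need no hypothesis beyond the field data.
Nothing here concerns [IUTchIII]; no statement of abc-iut-L1-t7 / abc-iut-L4-t2 is restated.
-/

noncomputable section

namespace Literature.AlgebraicGeometry.Frobenioids

namespace PadicKummer

open Field IntermediateField
open scoped ValuativeRel
open Literature.NumberTheory.GaloisRepresentations
open Literature.AnabelianGeometry.AbsoluteAnabelian (nonzeroIntegers unitSubmonoid integersClosure)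

section Integers

variable {K₁ K₂ : Type} [Field K₁] [Field K₂] [ValuativeRel K₁] [ValuativeRel K₂] (φ₀ : K₁ ≃+* K₂)
  (hφ₀ : ∀ x : K₁, x ∈ 𝒪[K₁] ↔ φ₀ x ∈ 𝒪[K₂])
  (φ : AlgebraicClosure K₁ ≃+* AlgebraicClosure K₂)
  (hφ : ∀ x : K₁, φ (algebraMap K₁ (AlgebraicClosure K₁) x) =
    algebraMap K₂ (AlgebraicClosure K₂) (φ₀ x))
  (L₁ : IntermediateField K₁ (AlgebraicClosure K₁)) (L₂ : IntermediateField K₂ (AlgebraicClosure K₂))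
  (hL : ∀ y : AlgebraicClosure K₁, y ∈ L₁ ↔ φ y ∈ L₂)

/-- `φ₀|_{𝒪_{K₁}} : 𝒪_{K₁} → 𝒪_{K₂}`. [cite: MochizukiFrdII2008, Thm 2.4 (i) p.20] -/
def integerHom : 𝒪[K₁] →+* 𝒪[K₂] :=
  φ₀.toRingHom.restrict 𝒪[K₁] 𝒪[K₂] fun x hx => (hφ₀ x).mp hx

include hφ₀ in
/-- `φ₀⁻¹` also identifies the valuation rings. [cite: MochizukiFrdII2008, Thm 2.4 (i) p.20] -/
theorem hφ₀_symm (y : K₂) : y ∈ 𝒪[K₂] ↔ φ₀.symm y ∈ 𝒪[K₁] := by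
  rw [hφ₀ (φ₀.symm y), RingEquiv.apply_symm_apply]

include hφ hφ₀ in
/-- Integrality over `𝒪_K` transports along `φ|_{L₁}` (over `φ₀|_{𝒪_{K₁}}`).
[cite: MochizukiFrdII2008, Thm 2.4 (i) p.20] -/
theorem isIntegral_fieldIsoL {x : L₁} (hx : IsIntegral 𝒪[K₁] x) :
    IsIntegral 𝒪[K₂] (fieldIsoL φ L₁ L₂ hL x) := by
  refine hx.map_of_comp_eq (integerHom φ₀ hφ₀) (fieldIsoL φ L₁ L₂ hL).toRingHom
    (RingHom.ext fun r => ?_)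
  apply Subtype.ext
  show ((algebraMap 𝒪[K₂] L₂ (integerHom φ₀ hφ₀ r) : L₂) : AlgebraicClosure K₂) =
    φ ((algebraMap 𝒪[K₁] L₁ r : L₁) : AlgebraicClosure K₁)
  rw [IsScalarTower.algebraMap_apply 𝒪[K₂] K₂ L₂, IsScalarTower.algebraMap_apply 𝒪[K₁] K₁ L₁]
  change algebraMap K₂ (AlgebraicClosure K₂) ((integerHom φ₀ hφ₀ r : 𝒪[K₂]) : K₂) =
    φ (algebraMap K₁ (AlgebraicClosure K₁) (r : K₁))
  rw [hφ]
  rfl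

include hφ hφ₀ in
/-- **`φ` carries `O^⊳_{L₁}` onto `O^⊳_{L₂}`** (the hypothesis `hS` of `Iso.ofLocalField` for
`triSubmonoid`). [cite: MochizukiFrdII2008, Thm 2.4 (i) p.20] -/
theorem mem_triSubmonoid_iff (x : L₁) :
    x ∈ (triSubmonoid K₁ L₁).toSubmonoid ↔ fieldIsoL φ L₁ L₂ hL x ∈ (triSubmonoid K₂ L₂).toSubmonoid := by
  change x ∈ nonzeroIntegers K₁ L₁ ↔ fieldIsoL φ L₁ L₂ hL x ∈ nonzeroIntegers K₂ L₂
  constructor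
  · rintro ⟨hx, hx0⟩
    exact ⟨isIntegral_fieldIsoL φ₀ hφ₀ φ hφ L₁ L₂ hL hx,
      (map_ne_zero_iff _ (fieldIsoL φ L₁ L₂ hL).injective).mpr hx0⟩
  · rintro ⟨hx, hx0⟩
    refine ⟨?_, (map_ne_zero_iff _ (fieldIsoL φ L₁ L₂ hL).injective).mp hx0⟩
    have h := isIntegral_fieldIsoL φ₀.symm (hφ₀_symm φ₀ hφ₀) φ.symm (hφ_symm φ₀ φ hφ) L₂ L₁
      (fun y => by rw [hL, RingEquiv.apply_symm_apply]) hx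
    have hval : fieldIsoL φ.symm L₂ L₁ (fun y => by rw [hL, RingEquiv.apply_symm_apply])
        (fieldIsoL φ L₁ L₂ hL x) = x := Subtype.ext (φ.symm_apply_apply _)
    rwa [hval] at h

include hφ hφ₀ in
/-- **`φ` carries `O^×_{L₁}` onto `O^×_{L₂}`** (`hS` for `unitsStableSubmonoid`).
[cite: MochizukiFrdII2008, Thm 2.4 (i) p.20] -/
theorem mem_unitsStableSubmonoid_iff (x : L₁) :
    x ∈ (unitsStableSubmonoid K₁ L₁).toSubmonoid ↔
      fieldIsoL φ L₁ L₂ hL x ∈ (unitsStableSubmonoid K₂ L₂).toSubmonoid := by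
  change x ∈ unitSubmonoid K₁ L₁ ↔ fieldIsoL φ L₁ L₂ hL x ∈ unitSubmonoid K₂ L₂
  constructor
  · rintro ⟨hx, y, hy, hxy⟩
    exact ⟨isIntegral_fieldIsoL φ₀ hφ₀ φ hφ L₁ L₂ hL hx, fieldIsoL φ L₁ L₂ hL y,
      isIntegral_fieldIsoL φ₀ hφ₀ φ hφ L₁ L₂ hL hy, by rw [← map_mul, hxy, map_one]⟩
  · rintro ⟨hx, y, hy, hxy⟩
    have hL' : ∀ y : AlgebraicClosure K₂, y ∈ L₂ ↔ φ.symm y ∈ L₁ := fun y => by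
      rw [hL, RingEquiv.apply_symm_apply]
    have hval : ∀ z : L₁, fieldIsoL φ.symm L₂ L₁ hL' (fieldIsoL φ L₁ L₂ hL z) = z :=
      fun z => Subtype.ext (φ.symm_apply_apply _)
    have hval' : ∀ w : L₂, fieldIsoL φ L₁ L₂ hL (fieldIsoL φ.symm L₂ L₁ hL' w) = w :=
      fun w => Subtype.ext (φ.apply_symm_apply _)
    have h1 := isIntegral_fieldIsoL φ₀.symm (hφ₀_symm φ₀ hφ₀) φ.symm (hφ_symm φ₀ φ hφ) L₂ L₁ hL' hx
    have h2 := isIntegral_fieldIsoL φ₀.symm (hφ₀_symm φ₀ hφ₀) φ.symm (hφ_symm φ₀ φ hφ) L₂ L₁ hL' hy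
    rw [hval] at h1
    refine ⟨h1, fieldIsoL φ.symm L₂ L₁ hL' y, h2, ?_⟩
    apply (fieldIsoL φ L₁ L₂ hL).injective
    rw [map_mul, hval', hxy, map_one]

include hφ hφ₀ in
/-- **`φ` carries `O^□_{L₁}` onto `O^□_{L₂}`** for Def. 2.2 (iii)'s `boxStableSubmonoid` (same
"fieldwise saturated" flag on both sides). [cite: MochizukiFrdII2008, Def 2.2 (iii) p.18] -/
theorem mem_boxStableSubmonoid_iff (fs : Prop) (x : L₁) :
    x ∈ (boxStableSubmonoid K₁ L₁ fs).toSubmonoid ↔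
      fieldIsoL φ L₁ L₂ hL x ∈ (boxStableSubmonoid K₂ L₂ fs).toSubmonoid := by
  unfold boxStableSubmonoid
  split_ifs
  · exact mem_triSubmonoid_iff φ₀ hφ₀ φ hφ L₁ L₂ hL x
  · exact mem_unitsStableSubmonoid_iff φ₀ hφ₀ φ hφ L₁ L₂ hL x

end Integers

/-! ### The context isomorphisms for `O^□ = O^⊳`, `O^×`, `O^□` without residual hypothesis on `S` -/

namespace Def22Context.Iso

variable {K₁ K₂ : Type} [Field K₁] [Field K₂] [ValuativeRel K₁] [ValuativeRel K₂] (φ₀ : K₁ ≃+* K₂)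
  (hφ₀ : ∀ x : K₁, x ∈ 𝒪[K₁] ↔ φ₀ x ∈ 𝒪[K₂])
  (φ : AlgebraicClosure K₁ ≃+* AlgebraicClosure K₂)
  (hφ : ∀ x : K₁, φ (algebraMap K₁ (AlgebraicClosure K₁) x) =
    algebraMap K₂ (AlgebraicClosure K₂) (φ₀ x))
  (L₁ : IntermediateField K₁ (AlgebraicClosure K₁)) (L₂ : IntermediateField K₂ (AlgebraicClosure K₂))
  [Normal K₁ L₁] [FiniteDimensional K₁ L₁] [Normal K₂ L₂] [FiniteDimensional K₂ L₂]
  (hL : ∀ y : AlgebraicClosure K₁, y ∈ L₁ ↔ φ y ∈ L₂)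
  (H₁ : Subgroup (absoluteGaloisGroup K₁)) [H₁.Normal]
  (hH₁ : IsOpen (H₁ : Set (absoluteGaloisGroup K₁)))
  (H₂ : Subgroup (absoluteGaloisGroup K₂)) [H₂.Normal]
  (hH₂ : IsOpen (H₂ : Set (absoluteGaloisGroup K₂)))
  (hH : H₁.map (galConjₜ φ₀ φ hφ).toMulEquiv.toMonoidHom = H₂)

/-- The context isomorphism between the arithmetic contexts with `O^□ = O^⊳_L` induced by a
valuative isomorphism of the field data. [cite: MochizukiFrdII2008, Thm 2.4 (i) p.19] -/
def ofLocalFieldTri :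
    Iso (Def22Context.ofLocalField L₁ H₁ hH₁ (triSubmonoid K₁ L₁))
      (Def22Context.ofLocalField L₂ H₂ hH₂ (triSubmonoid K₂ L₂)) :=
  ofLocalField φ₀ φ hφ L₁ L₂ hL H₁ hH₁ H₂ hH₂ hH _ _ (mem_triSubmonoid_iff φ₀ hφ₀ φ hφ L₁ L₂ hL)

/-- The context isomorphism between the arithmetic contexts with `O^□ = O^×_L` induced by a
valuative isomorphism of the field data. [cite: MochizukiFrdII2008, Thm 2.4 (i) p.19] -/
def ofLocalFieldUnits :
    Iso (Def22Context.ofLocalField L₁ H₁ hH₁ (unitsStableSubmonoid K₁ L₁))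
      (Def22Context.ofLocalField L₂ H₂ hH₂ (unitsStableSubmonoid K₂ L₂)) :=
  ofLocalField φ₀ φ hφ L₁ L₂ hL H₁ hH₁ H₂ hH₂ hH _ _
    (mem_unitsStableSubmonoid_iff φ₀ hφ₀ φ hφ L₁ L₂ hL)

/-- The context isomorphism between the arithmetic contexts with `O^□` as in Def. 2.2 (iii) (same
"fieldwise saturated" flag `fs`). [cite: MochizukiFrdII2008, Def 2.2 (iii) p.18] -/
def ofLocalFieldBox (fs : Prop) :
    Iso (Def22Context.ofLocalField L₁ H₁ hH₁ (boxStableSubmonoid K₁ L₁ fs))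
      (Def22Context.ofLocalField L₂ H₂ hH₂ (boxStableSubmonoid K₂ L₂ fs)) :=
  ofLocalField φ₀ φ hφ L₁ L₂ hL H₁ hH₁ H₂ hH₂ hH _ _
    (mem_boxStableSubmonoid_iff φ₀ hφ₀ φ hφ L₁ L₂ hL fs)

end Def22Context.Iso

end PadicKummer

end Literature.AlgebraicGeometry.Frobenioids
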